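import Summits.ABC.ABC.Theorems.RibetTakahashiSplitManyPrimeValuationProductCoveringGlue
import Summits.ABC.ABC.Theorems.RibetTakahashiSplitManyPrimeValuationProductJLPackageLemmas
import Summits.ABC.ABC.Theorems.RibetTakahashiSplitManyPrimeValuationProductJLDegreePackageOfRadius
import Summits.ABC.ABC.Theorems.RibetTakahashiSplitManyPrimeValuationProductShimuraDegreeLowerBoundOfPaired
import Literature.NumberTheory.Automorphic.ShimuraCurve

/-!
# The lever of crux line `jl-zero-cycle-height` in DEGREE form, calibrated in tree vocabulary:
# the Shimura degree lower bound suffices for `RibetTakahashiSplit.ManyPrimeValuationProduct`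
# (stmt-ABC-1561), and does so modulo five cited theorems and the route item `MazurKenkuRadius`

Route `RibetTakahashiSplit`, crux r2 `ManyPrimeValuationProduct` (stmt-ABC-1561), line
`jl-zero-cycle-height` (`Cruxes/ManyPrimeValuationProduct/Lines/jl_zero_cycle_height.lean`, rev c4).
Rev c4 registers the line's hard stub in DEGREE form — the SHIMURA DEGREE LOWER BOUND: for every
`ε > 0` there is `C` such that for every globally minimal elliptic `W/ℚ` semistable away from `2`,
every covering set `D` of multiplicative primes (`#D` even, `≥ 2`, two multiplicative primes outside
`D`; `N = (∏D)·M`), every Shimura-curve datum `X` of level `(∏D, M)` and every parametrisation datum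
`P` of `W` on `X`, `log P.deg ≥ log vol(X.fd) − log covol(Λ_P) − ε log N − C` — i.e.
`δ_{D,M}(E)·covol(Λ_E) ≥ e^{−C} N^{−ε} vol(X_0^D(M))`, the quaternionic twin of Zagier + GHL on
`X_0(N)`. This file lands, with every abbreviation of the skeleton unfolded (signatures verbatim the
skeleton's `FermatInputOnClass → JLDegreePackage → ShimuraDegreeLowerBound → ManyPrimeValuationProduct`
by definitional unfolding):

* `manyPrimeValuationProduct_of_degreeLever` (registered stub) — **the degree lever suffices**: the
  Fermat input on the class, the Jacquet–Langlands/Ribet–Takahashi/Pasten package in DEGREE form (for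
  every covering set a global minimal model `C₀ • W`, a datum `X` and a datum `P` of `C₀ • W` on `X`
  with `log T_D ≤ C + ε log N + log vol(X.fd) − log P.deg − log covol Λ_P`) and the degree lever give
  the crux: per covering set `log T_D ≤ C₁ + C₂ + ε log N` (the lever applied to the package's own
  datum), then the covering glue (`manyPrimeValuationProduct_of_pairedFactorisationBound`).
* `manyPrimeValuationProduct_of_routeFacts_of_degreeLever` — the same with the package supplied by the
  landed `stub_jlDegreePackageOfRadius` (p121499): Fermat input on the class + Jacquet–Langlands
  existence + Pasten Thm 6.1 (b′) at `S = {2}` + optimal `X₀(N)`-quotient + Cor 10.2 + `‖f‖² ≪ N log N`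
  + `MazurKenkuRadius` + the degree lever ⟹ the crux, BY NAME.

With the landed converse `stub_shimuraDegreeLowerBoundOfPaired` (p121504: Thm 6.1 numerator + optimal
quotient + GHL + radius + paired crux ⟹ degree lever) this makes "degree lever ⟺ paired crux modulo
cited theorems" importable from `Theorems/` — the statement a planner promotes when promoting stub 4.
No definitions; theorems only. References: H. Pasten, *Shimura curves and the abc conjecture*,
J. Number Theory 254 (2024) = arXiv:1705.09251, Thm 6.1, §16.
-/

-- `Summit.ABC.ABC` is the mandated summit-side namespace (CONVENTIONS §2); the duplicate is deliberate.
set_option linter.dupNamespace false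

noncomputable section

open MeasureTheory

namespace Summit.ABC.ABC.Theorems.ManyPrimeValuationProduct

/-- **The degree lever suffices for the crux** (registered stub `manyPrimeValuationProduct_of_degreeLever`
of line `jl-zero-cycle-height`, rev c4; = the skeleton's `coveringGlue ∘ pairedFactorisationBound_of_degree
∘ fermatInputOnClass`, abbreviations unfolded): Fermat input on the class → degree package → degree
lever → `ManyPrimeValuationProduct`. Per covering set: the package gives `(C₀, X, P)` with
`log T_D ≤ C₁ + (ε/2) log N + log vol − log P.deg − log covol`, the lever (applied to the global minimal
model `C₀ • W`, same conductor) gives `log vol − log covol − (ε/2) log N − C₂ ≤ log P.deg`, so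
`T_D ≤ exp(C₁+C₂) N^ε`; then the covering glue. [folklore] -/
theorem manyPrimeValuationProduct_of_degreeLever : (∀ (W : WeierstrassCurve ℚ) [W.IsElliptic], (∀ p : ℕ, p.Prime → p ≠ 2 → ¬ p ^ 2 ∣ W.conductorNorm ℤ) → 4 ≤ ((W.conductorNorm ℤ).primeFactors.filter (fun p => ¬ p ^ 2 ∣ W.conductorNorm ℤ)).card → (∀ ℓ : ℕ, ℓ.Prime → 11 ≤ ℓ → ∃ r ∈ (W.conductorNorm ℤ).primeFactors.filter (fun p => ¬ p ^ 2 ∣ W.conductorNorm ℤ), ¬ ℓ ∣ (W.minimalDiscriminantNorm ℤ).factorization r)) → (∀ ε : ℝ, 0 < ε → ∃ C : ℝ, ∀ (W : WeierstrassCurve ℚ) [W.IsElliptic], (∀ p : ℕ, p.Prime → p ≠ 2 → ¬ p ^ 2 ∣ W.conductorNorm ℤ) → (∀ ℓ : ℕ, ℓ.Prime → 11 ≤ ℓ → ∃ r ∈ (W.conductorNorm ℤ).primeFactors.filter (fun p => ¬ p ^ 2 ∣ W.conductorNorm ℤ), ¬ ℓ ∣ (W.minimalDiscriminantNorm ℤ).factorization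 r) → ∀ D : Finset ℕ, (D ⊆ (W.conductorNorm ℤ).primeFactors.filter (fun p => ¬ p ^ 2 ∣ W.conductorNorm ℤ) ∧ Even D.card ∧ 2 ≤ D.card ∧ 2 ≤ ((W.conductorNorm ℤ).primeFactors.filter (fun p => ¬ p ^ 2 ∣ W.conductorNorm ℤ) \ D).card) → ∃ C₀ : WeierstrassCurve.VariableChange ℚ, (C₀ • W).IsGloballyMinimal ∧ ∃ (X : Literature.NumberTheory.Automorphic.ShimuraCurveData (∏ p ∈ D, p) (W.conductorNorm ℤ / ∏ p ∈ D, p)) (P : Literature.NumberTheory.Automorphic.ShimuraParametrizationData X (C₀ • W)), Real.log ((∏ p ∈ D, (W.minimalDiscriminantNorm ℤ).factorization p : ℕ) : ℝ) ≤ C + ε * Real.log (W.conductorNorm ℤ) + Real.log (MeasureTheory.volume X.fd).toReal - (Real.log (P.deg : ℝ) + Real.log (ZLattice.covolume P.L.lattice))) → (∀ ε : ℝ, 0 < ε → ∃ C : ℝ, ∀ (W : WeierstrassCurve ℚ) [W.IsElliptic] [W.IsGloballyMinimal], (∀ p : ℕ, p.Prime → p ≠ 2 → ¬ p ^ 2 ∣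 W.conductorNorm ℤ) → ∀ D : Finset ℕ, (D ⊆ (W.conductorNorm ℤ).primeFactors.filter (fun p => ¬ p ^ 2 ∣ W.conductorNorm ℤ) ∧ Even D.card ∧ 2 ≤ D.card ∧ 2 ≤ ((W.conductorNorm ℤ).primeFactors.filter (fun p => ¬ p ^ 2 ∣ W.conductorNorm ℤ) \ D).card) → ∀ M : ℕ, (∏ p ∈ D, p) * M = W.conductorNorm ℤ → ∀ (X : Literature.NumberTheory.Automorphic.ShimuraCurveData (∏ p ∈ D, p) M) (P : Literature.NumberTheory.Automorphic.ShimuraParametrizationData X W), Real.log (MeasureTheory.volume X.fd).toReal - Real.log (ZLattice.covolume P.L.lattice) - (ε * Real.log (W.conductorNorm ℤ) + C) ≤ Real.log (P.deg : ℝ)) → Summit.ABC.ABC.Theses.RibetTakahashiSplit.ManyPrimeValuationProduct := by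
  intro hFI hJ hL
  refine manyPrimeValuationProduct_of_pairedFactorisationBound fun ε hε => ?_
  have hε2 : 0 < ε / 2 := half_pos hε
  obtain ⟨C₁, hC₁⟩ := hJ (ε / 2) hε2
  obtain ⟨C₂, hC₂⟩ := hL (ε / 2) hε2
  refine ⟨Real.exp (C₁ + C₂), fun W _ hss D hsub heven h2 h2' => ?_⟩
  have h4 : 4 ≤ ((W.conductorNorm ℤ).primeFactors.filter
      (fun p => ¬ p ^ 2 ∣ W.conductorNorm ℤ)).card := by
    have h := Finset.card_sdiff_add_card_eq_card hsub
    omega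
  have hF := hFI W hss h4
  obtain ⟨C₀, hmin, X, P, hineq⟩ := hC₁ W hss hF D ⟨hsub, heven, h2, h2'⟩
  haveI := hmin
  have hNeq : (C₀ • W).conductorNorm ℤ = W.conductorNorm ℤ :=
    WeierstrassCurve.conductorNorm_smul_rat W C₀
  obtain ⟨hadm, -⟩ := JLPackage.admissible_of_isCoveringSet hsub heven
  have hMeq : (∏ p ∈ D, p) * (W.conductorNorm ℤ / ∏ p ∈ D, p) = (C₀ • W).conductorNorm ℤ := by
    rw [hNeq]; exact hadm.mul_eq
  have hssm : ∀ p : ℕ, p.Prime → p ≠ 2 → ¬ p ^ 2 ∣ (C₀ • W).conductorNorm ℤ := by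
    rw [hNeq]; exact hss
  have hDm : D ⊆ ((C₀ • W).conductorNorm ℤ).primeFactors.filter
        (fun p => ¬ p ^ 2 ∣ (C₀ • W).conductorNorm ℤ) ∧ Even D.card ∧ 2 ≤ D.card ∧
      2 ≤ (((C₀ • W).conductorNorm ℤ).primeFactors.filter
        (fun p => ¬ p ^ 2 ∣ (C₀ • W).conductorNorm ℤ) \ D).card := by
    rw [hNeq]; exact ⟨hsub, heven, h2, h2'⟩
  have hm := hC₂ (C₀ • W) hssm D hDm (W.conductorNorm ℤ / ∏ p ∈ D, p) hMeq X P
  rw [hNeq] at hm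
  set N : ℝ := (W.conductorNorm ℤ : ℝ) with hNdef
  set T : ℕ := ∏ p ∈ D, (W.minimalDiscriminantNorm ℤ).factorization p with hTdef
  have hlogT : Real.log (T : ℝ) ≤ C₁ + C₂ + ε * Real.log N := by linarith
  have hN0 : 0 < W.conductorNorm ℤ := W.conductorNorm_pos_holds
  have hN : 0 < N := by rw [hNdef]; exact_mod_cast hN0
  have hT : (T : ℝ) ≤ Real.exp (Real.log (T : ℝ)) := by
    rcases Nat.eq_zero_or_pos T with h | h
    · rw [h]; simp
    · rw [Real.exp_log (by exact_mod_cast h)]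
  calc (T : ℝ) ≤ Real.exp (Real.log (T : ℝ)) := hT
    _ ≤ Real.exp (C₁ + C₂ + ε * Real.log N) := Real.exp_le_exp.mpr hlogT
    _ = Real.exp (C₁ + C₂) * N ^ ε := by
        rw [Real.exp_add, Real.rpow_def_of_pos hN, mul_comm (Real.log N) ε]

/-- **The crux from the route's cited facts, the route item `MazurKenkuRadius` and the degree lever,
BY NAME** (rev c4 summary in tree vocabulary): Fermat input on the class → Jacquet–Langlands existence →
Pasten Thm 6.1 (b′) at `S = {2}` (written out) → optimal `X₀(N)`-quotient → Cor 10.2 → `‖f‖² ≪ N log N`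
→ `MazurKenkuRadius` → degree lever → `ManyPrimeValuationProduct`; the package is the landed
`stub_jlDegreePackageOfRadius` (p121499). [folklore] -/
theorem manyPrimeValuationProduct_of_routeFacts_of_degreeLever
    (hFI : ∀ (W : WeierstrassCurve ℚ) [W.IsElliptic], (∀ p : ℕ, p.Prime → p ≠ 2 → ¬ p ^ 2 ∣ W.conductorNorm ℤ) → 4 ≤ ((W.conductorNorm ℤ).primeFactors.filter (fun p => ¬ p ^ 2 ∣ W.conductorNorm ℤ)).card → (∀ ℓ : ℕ, ℓ.Prime → 11 ≤ ℓ → ∃ r ∈ (W.conductorNorm ℤ).primeFactors.filter (fun p => ¬ p ^ 2 ∣ W.conductorNorm ℤ), ¬ ℓ ∣ (W.minimalDiscriminantNorm ℤ).factorization r))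
    (hJL : Literature.NumberTheory.Automorphic.nonempty_shimuraParametrizationData)
    (h61 : ∃ κ : ℕ, 1 ≤ κ ∧ (∀ q ∈ κ.primeFactors, q ≤ 163) ∧
      ∀ {N D M : ℕ} [NeZero N], Literature.NumberTheory.Automorphic.IsAdmissibleFactorization N D M →
      ∀ (X : Literature.NumberTheory.Automorphic.ShimuraCurveData D M) (W : WeierstrassCurve ℚ)
        [W.IsElliptic] [W.IsGloballyMinimal],
        W.conductorNorm ℤ = N → (∀ q : ℕ, q.Prime → q ∉ ({2} : Finset ℕ) → ¬ q ^ 2 ∣ N) →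
        (∀ ℓ : ℕ, ℓ.Prime → 11 ≤ ℓ → ∃ r : ℕ, r.Prime ∧ r ∣ N ∧ ¬ r ^ 2 ∣ N ∧
          ¬ ℓ ∣ (W.minimalDiscriminantNorm ℤ).factorization r) →
        (M.primeFactors.filter fun t => ¬ t ^ 2 ∣ N).card ≠ 1 →
      ∀ (W₁ : WeierstrassCurve ℚ) [W₁.IsElliptic]
        (D₁ : Literature.NumberTheory.EllipticCurves.ModularForms.ModularParametrizationData W₁ N),
        Literature.NumberTheory.EllipticCurves.ModularForms.IsNewformOf W D₁.f →
        (∀ (W₂ : WeierstrassCurve ℚ) [W₂.IsElliptic]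
            (D₂ : Literature.NumberTheory.EllipticCurves.ModularForms.ModularParametrizationData W₂ N),
            D₂.f = D₁.f → D₁.modularDegree ≤ D₂.modularDegree) →
      ∀ (W' : WeierstrassCurve ℚ) [W'.IsElliptic]
        (P : Literature.NumberTheory.Automorphic.ShimuraParametrizationData X W'),
        P.IsMinimalFor W →
          ∃ a b : ℕ, 0 < a ∧ 0 < b ∧ b ∣ κ ^ D.primeFactors.card ∧
            D₁.modularDegree * b =
              a * P.deg * ∏ p ∈ D.primeFactors, (W.minimalDiscriminantNorm ℤ).factorization p)
    (hopt : Literature.NumberTheory.Automorphic.exists_optimal_modularParametrizationData)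
    (hManin : Literature.NumberTheory.Automorphic.PastenShimura2024_cor_10_2)
    (hPet : Literature.NumberTheory.Automorphic.murty_petersson_newform_upper_bound)
    (hR : Summit.ABC.ABC.Theses.RibetTakahashiSplit.MazurKenkuRadius)
    (hL : ∀ ε : ℝ, 0 < ε → ∃ C : ℝ, ∀ (W : WeierstrassCurve ℚ) [W.IsElliptic] [W.IsGloballyMinimal], (∀ p : ℕ, p.Prime → p ≠ 2 → ¬ p ^ 2 ∣ W.conductorNorm ℤ) → ∀ D : Finset ℕ, (D ⊆ (W.conductorNorm ℤ).primeFactors.filter (fun p => ¬ p ^ 2 ∣ W.conductorNorm ℤ) ∧ Even D.card ∧ 2 ≤ D.card ∧ 2 ≤ ((W.conductorNorm ℤ).primeFactors.filter (fun p => ¬ p ^ 2 ∣ W.conductorNorm ℤ) \ D).card) → ∀ M : ℕ, (∏ p ∈ D, p) * M = W.conductorNorm ℤ → ∀ (X : Literature.NumberTheory.Automorphic.ShimuraCurveData (∏ p ∈ D, p) M) (P : Literature.NumberTheory.Automorphic.ShimuraParametrizationData X W), Real.log (MeasureTheory.volume X.fd).toReal - Real.log (ZLattice.covolume P.L.lattice)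 - (ε * Real.log (W.conductorNorm ℤ) + C) ≤ Real.log (P.deg : ℝ)) :
    Summit.ABC.ABC.Theses.RibetTakahashiSplit.ManyPrimeValuationProduct :=
  manyPrimeValuationProduct_of_degreeLever hFI (stub_jlDegreePackageOfRadius hJL h61 hopt hManin hPet hR) hL

end Summit.ABC.ABC.Theorems.ManyPrimeValuationProduct

end
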